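import Summits.AtomisticToContinuum.Crystallization.Theorems.ExcessDecayLiouvillePhononStabilityLatticeSum
import Summits.AtomisticToContinuum.Crystallization.Theorems.ExcessDecayLiouvillePhononStabilityLabels
import Summits.AtomisticToContinuum.Crystallization.Theorems.ExcessDecayLiouvillePhononStabilityPullback
import Summits.AtomisticToContinuum.Crystallization.Theorems.ExcessDecayLiouvillePhononStabilityWindow
import Summits.AtomisticToContinuum.Crystallization.Theorems.ExcessDecayLiouvillePhononStabilityTail
import Summits.AtomisticToContinuum.Crystallization.Theorems.ExcessDecayLiouvillePhononStabilityDilation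

/-!
# `PhononStability` (stmt-AtomisticToContinuum-9333), line `contragredient-window-collapse`: the composition

The crux `Theses.ExcessDecayLiouville.PhononStability` (uniform harmonic stability of Lennard-Jones over the
admissible affine-hcp window) REDUCED to the line's transfer target `VertexCertificate`
(`Theorems/ExcessDecayLiouvillePhononStabilityDefs.lean`): a finite family of fixed-coefficient reference operators
covering the dilation-extreme sheet of the window by dominated data (`Cover`), each coercive against the explicit
tail functional on its metric/shift cell (`Coercive`).  All six reductions of the line are landed theorems
(`stub_latticeSum`, `stub_labels`, `stub_pullback`, `stub_window`, `stub_tail`, `stub_dilation`); this file proves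
the vertex principle `key_nonneg` (affine + monotone in the data, exact in metric and shift), the sorry-free
`composition` (label model and pull-back at the datum; tail control `Fform ≥ G_R`; dilation to an extreme point
`G_R ≥ s¹⁰·G_R^ext`; vertex principle `G_R^ext ≥ 0`), and the registered anchor
`stub_composition : VertexCertificate → PhononStability` — the crux is closed modulo `VertexCertificate` exactly as
typed.  The lead's format diagnostics for `VertexCertificate` (kit j015111) are recorded on the item.
Elementary glue (Gram band of `A⁻ᵀ`, `‖δ‖ ≤ 5/189`, `Nform`/`Hform` splits) is kept private here.  All `[folklore]`.
-/

noncomputable section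

open scoped BigOperators Classical InnerProductSpace
open Filter Set Function
open Literature.MathematicalPhysics.StatisticalMechanics
open Summit.AtomisticToContinuum.Crystallization.Theses.ExcessDecayLiouville
open Summit.AtomisticToContinuum.Crystallization.Theorems.PhononStabilityNegative
open Summit.AtomisticToContinuum.Crystallization.Theorems.PhononStabilityCWC

namespace Summit.AtomisticToContinuum.Crystallization.Theorems.PhononStabilityCWC.Composition

/-! ## Private glue -/

/-- `X_c ≥ 0`. [folklore] -/
private theorem longForm_nonneg (δ : EuclideanSpace ℝ (Fin 3)) (c : BondClass) (w : Label → EuclideanSpace ℝ (Fin 3)) : 0 ≤ longForm δ c w :=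
  tsum_nonneg fun _ => by positivity

/-- `Y_c ≥ 0`. [folklore] -/
private theorem metricForm_nonneg (B : EuclideanSpace ℝ (Fin 3) →L[ℝ] EuclideanSpace ℝ (Fin 3)) (c : BondClass) (w : Label → EuclideanSpace ℝ (Fin 3)) : 0 ≤ metricForm B c w :=
  tsum_nonneg fun _ => by positivity

/-- Scaling a contragredient pair: `(sA, s⁻¹B)` is again contragredient. [folklore] -/
private theorem contragredient_smul {A B : EuclideanSpace ℝ (Fin 3) →L[ℝ] EuclideanSpace ℝ (Fin 3)} (h : Contragredient A B) {s : ℝ} (hs : s ≠ 0) :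
    Contragredient (s • A) (s⁻¹ • B) := by
  intro x y
  have h1 : (s • A) x = s • A x := rfl
  have h2 : (s⁻¹ • B) y = s⁻¹ • B y := rfl
  rw [h1, h2, real_inner_smul_left, real_inner_smul_right, h x y]
  field_simp

/-- A cell in the window is injective … [folklore] -/
private theorem injective_of_cellWindow {A : EuclideanSpace ℝ (Fin 3) →L[ℝ] EuclideanSpace ℝ (Fin 3)} (hW : CellWindow A) : Function.Injective A := by
  intro x x' h
  have h1 := (hW (x - x')).1
  rw [map_sub, h, sub_self, norm_zero] at h1
  have h2 : ‖x - x'‖ ≤ 0 := by linarith [norm_nonneg (x - x')]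
  exact sub_eq_zero.mp (norm_le_zero_iff.mp h2)

/-- … hence surjective (finite dimension). [folklore] -/
private theorem surjective_of_cellWindow {A : EuclideanSpace ℝ (Fin 3) →L[ℝ] EuclideanSpace ℝ (Fin 3)} (hW : CellWindow A) : Function.Surjective A := by
  have h : Function.Injective (A : EuclideanSpace ℝ (Fin 3) →ₗ[ℝ] EuclideanSpace ℝ (Fin 3)) := injective_of_cellWindow hW
  exact LinearMap.injective_iff_surjective.mp h

/-- **Shift bound:** `‖δ‖ ≤ 5/189` from `‖Aδ‖ ≤ 1/40` and the lower stretch `189/200`. [folklore] -/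
private theorem norm_shift_le {A : EuclideanSpace ℝ (Fin 3) →L[ℝ] EuclideanSpace ℝ (Fin 3)} {δ : EuclideanSpace ℝ (Fin 3)} (hW : CellWindow A) (hδ : ShiftWindow A δ) :
    ‖δ‖ ≤ 5 / 189 := by
  have h1 := (hW δ).1
  unfold ShiftWindow at hδ
  linarith

/-- **Gram band:** the contragredient `B = A⁻ᵀ` of a window cell has stretches in `[200/199, 200/189]`.
(This is where `phononStability_false_without_Adm` is honoured: without `CellWindow` there is no such `B`.) [folklore] -/
private theorem metricBand_of_contragredient {A B : EuclideanSpace ℝ (Fin 3) →L[ℝ] EuclideanSpace ℝ (Fin 3)} (hW : CellWindow A) (hAB : Contragredient A B) :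
    MetricBand B := by
  intro y
  constructor
  · have h1 : ‖y‖ ^ 2 = inner ℝ (A y) (B y) := by rw [hAB, real_inner_self_eq_norm_sq]
    have h2 : inner ℝ (A y) (B y) ≤ ‖A y‖ * ‖B y‖ := real_inner_le_norm _ _
    have h3 := (hW y).2
    have hy := norm_nonneg y
    have hBy := norm_nonneg (B y)
    by_cases hy0 : ‖y‖ = 0
    · rw [hy0]; simp
    · have hypos : 0 < ‖y‖ := lt_of_le_of_ne hy (Ne.symm hy0)
      have h4 : ‖y‖ ^ 2 ≤ 199 / 200 * ‖y‖ * ‖B y‖ := by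
        calc ‖y‖ ^ 2 ≤ ‖A y‖ * ‖B y‖ := by rw [h1]; exact h2
          _ ≤ 199 / 200 * ‖y‖ * ‖B y‖ := by gcongr
      have h5 : ‖y‖ ≤ 199 / 200 * ‖B y‖ := by
        have : ‖y‖ * ‖y‖ ≤ ‖y‖ * (199 / 200 * ‖B y‖) := by nlinarith
        exact le_of_mul_le_mul_left this hypos
      linarith
  · obtain ⟨x, hx⟩ := surjective_of_cellWindow hW (B y)
    have h1 : ‖B y‖ ^ 2 = inner ℝ x y := by rw [← hAB, hx, real_inner_self_eq_norm_sq]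
    have h2 : inner ℝ x y ≤ ‖x‖ * ‖y‖ := real_inner_le_norm _ _
    have h3 := (hW x).1
    rw [hx] at h3
    have hy := norm_nonneg y
    have hBy := norm_nonneg (B y)
    by_cases hB0 : ‖B y‖ = 0
    · rw [hB0]; positivity
    · have hBpos : 0 < ‖B y‖ := lt_of_le_of_ne hBy (Ne.symm hB0)
      have h4 : ‖B y‖ ^ 2 ≤ 200 / 189 * ‖B y‖ * ‖y‖ := by
        calc ‖B y‖ ^ 2 ≤ ‖x‖ * ‖y‖ := by rw [h1]; exact h2
          _ ≤ 200 / 189 * ‖B y‖ * ‖y‖ := by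
              have hx' : ‖x‖ ≤ 200 / 189 * ‖B y‖ := by linarith
              gcongr
      have : ‖B y‖ * ‖B y‖ ≤ ‖B y‖ * (200 / 189 * ‖y‖) := by nlinarith
      have h5 := le_of_mul_le_mul_left this hBpos
      linarith

/-- The metric functional of a diagonal class vanishes. [folklore] -/
private theorem metricForm_diag (B : EuclideanSpace ℝ (Fin 3) →L[ℝ] EuclideanSpace ℝ (Fin 3)) (w : Label → EuclideanSpace ℝ (Fin 3)) {c : BondClass} (hc : diagClass c) :
    metricForm B c w = 0 := by
  obtain ⟨m, m', n⟩ := c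
  obtain ⟨h1, h2⟩ := hc
  simp only at h1 h2
  subst h1; subst h2
  simp [metricForm, bondDiff]

/-- Bond-graph constancy turns the metric cut-off of `Nform` into the finite nearest-neighbour sum. [folklore] -/
private theorem Nform_eq_sum {A B : EuclideanSpace ℝ (Fin 3) →L[ℝ] EuclideanSpace ℝ (Fin 3)} {δ : EuclideanSpace ℝ (Fin 3)} {w : Label → EuclideanSpace ℝ (Fin 3)}
    (hgraph : ∀ c : BondClass, ¬ diagClass c → (c ∈ nnClasses ↔ ‖A (bondVec δ c)‖ ≤ 11 / 10)) :
    Nform A B δ w = ∑ c ∈ nnClasses, metricForm B c w := by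
  have key : ∀ c : BondClass, (if ‖A (bondVec δ c)‖ ≤ 11 / 10 then metricForm B c w else 0) =
      if c ∈ nnClasses then metricForm B c w else 0 := by
    intro c
    by_cases hd : diagClass c
    · simp [metricForm_diag B w hd]
    · by_cases hc : c ∈ nnClasses
      · rw [if_pos ((hgraph c hd).1 hc), if_pos hc]
      · rw [if_neg (fun h => hc ((hgraph c hd).2 h)), if_neg hc]
  unfold Nform
  rw [tsum_congr key, tsum_eq_sum (s := nnClasses) (fun c hc => if_neg hc)]
  exact Finset.sum_congr rfl fun c hc => if_pos hc

/-- Splitting `Hform` at range `R`: finite part plus far `tsum`, for a summable class family. [folklore] -/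
private theorem Hform_eq_sum_add_tsum {A B : EuclideanSpace ℝ (Fin 3) →L[ℝ] EuclideanSpace ℝ (Fin 3)} {δ : EuclideanSpace ℝ (Fin 3)} {w : Label → EuclideanSpace ℝ (Fin 3)} (R : ℝ)
    (hs : Summable (classTerm A B δ w)) :
    Hform A B δ w = (∑ c ∈ classesR R, classTerm A B δ w c) +
      ∑' c, if c ∈ classesR R then 0 else classTerm A B δ w c := by
  unfold Hform
  have h1 : (fun c => classTerm A B δ w c) =
      fun c => (if c ∈ classesR R then classTerm A B δ w c else 0) +
        (if c ∈ classesR R then 0 else classTerm A B δ w c) := by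
    funext c; split_ifs <;> simp
  have hfin : Summable fun c => if c ∈ classesR R then classTerm A B δ w c else 0 :=
    summable_of_hasFiniteSupport ((classesR R).finite_toSet.subset (by
      intro c hc; by_contra h; exact hc (if_neg h)))
  have hfar : Summable fun c => if c ∈ classesR R then 0 else classTerm A B δ w c := by
    have : (fun c => if c ∈ classesR R then 0 else classTerm A B δ w c) =
        fun c => classTerm A B δ w c - if c ∈ classesR R then classTerm A B δ w c else 0 := by
      funext c; split_ifs <;> simp
    rw [this]; exact hs.sub hfin
  rw [show (∑' c, classTerm A B δ w c) = ∑' c, ((if c ∈ classesR R then classTerm A B δ w c else 0) +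
      (if c ∈ classesR R then 0 else classTerm A B δ w c)) from by rw [← h1], hfin.tsum_add hfar,
    tsum_eq_sum (s := classesR R) (fun c hc => if_neg hc)]
  congr 1
  exact Finset.sum_congr rfl fun c hc => if_pos hc

/-! ## The vertex principle (proved) -/

/-- **The vertex principle on the dilation-extreme sheet.** Affine + monotone in the data, exact in `(B, δ)`:
cover and per-vertex coercivity give `0 ≤ GR κ R` (truncated form with tail charge) at every extreme point. [folklore] -/
theorem key_nonneg (h2 : WindowGeometry) {κ R : ℝ} {n : ℕ}
    {V : Fin n → Vertex} (hcov : Cover R V) (hcoe : ∀ i, Coercive κ R (V i))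
    {A B : EuclideanSpace ℝ (Fin 3) →L[ℝ] EuclideanSpace ℝ (Fin 3)} {δ : EuclideanSpace ℝ (Fin 3)} (hext : ExtWindow A δ) (hAB : Contragredient A B)
    {w : Label → EuclideanSpace ℝ (Fin 3)} (hw : (Function.support w).Finite) : 0 ≤ GR κ R A B δ w := by
  have hband : MetricBand B := metricBand_of_contragredient hext.1 hAB
  have hδ' : ‖δ‖ ≤ 5 / 189 := norm_shift_le hext.1 hext.2.1
  obtain ⟨hgraph, -, -, -⟩ := h2 A δ hext.1 hext.2.1
  obtain ⟨μ, hμ0, hμ1, hcell, hdom⟩ := hcov A B δ hext hAB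
  have hNf : Nform A B δ w = ∑ c ∈ nnClasses, metricForm B c w := Nform_eq_sum hgraph
  -- domination of the finite-range part by the convex combination of the vertices' data
  have hdomsum :
      ∑ i, μ i * (∑ c ∈ classesR R, ((V i).a c * longForm δ c w + (V i).b c * metricForm B c w)) ≤
        ∑ c ∈ classesR R, classTerm A B δ w c := by
    calc ∑ i, μ i * (∑ c ∈ classesR R, ((V i).a c * longForm δ c w + (V i).b c * metricForm B c w))
        = ∑ c ∈ classesR R, ((∑ i, μ i * (V i).a c) * longForm δ c w +
            (∑ i, μ i * (V i).b c) * metricForm B c w) := by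
          simp_rw [Finset.mul_sum]
          rw [Finset.sum_comm]
          refine Finset.sum_congr rfl fun c _ => ?_
          rw [Finset.sum_mul, Finset.sum_mul, ← Finset.sum_add_distrib]
          exact Finset.sum_congr rfl fun i _ => by ring
      _ ≤ ∑ c ∈ classesR R, classTerm A B δ w c := by
          refine Finset.sum_le_sum fun c hc => ?_
          obtain ⟨ha, hb⟩ := hdom c hc
          have h₁ := mul_le_mul_of_nonneg_right ha (longForm_nonneg δ c w)
          have h₂ := mul_le_mul_of_nonneg_right hb (metricForm_nonneg B c w)
          unfold classTerm
          linarith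
  -- per-vertex coercivity, weighted
  have hvert : ∀ i, μ i * tailForm R w ≤ μ i * PhiR κ R (V i) B δ w := by
    intro i
    by_cases hμ : μ i = 0
    · simp [hμ]
    · obtain ⟨hBcell, hδcell⟩ := hcell i hμ
      exact mul_le_mul_of_nonneg_left (hcoe i B δ w hband hBcell hδcell hδ' hw) (hμ0 i)
  have hsumvert : tailForm R w ≤ ∑ i, μ i * PhiR κ R (V i) B δ w := by
    calc tailForm R w = ∑ i, μ i * tailForm R w := by rw [← Finset.sum_mul, hμ1, one_mul]
      _ ≤ ∑ i, μ i * PhiR κ R (V i) B δ w := Finset.sum_le_sum fun i _ => hvert i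
  -- the weighted sum of the vertex operators, expanded
  have hPhi : ∑ i, μ i * PhiR κ R (V i) B δ w =
      ∑ i, μ i * (∑ c ∈ classesR R, ((V i).a c * longForm δ c w + (V i).b c * metricForm B c w)) -
        2 * κ * ∑ c ∈ nnClasses, metricForm B c w := by
    simp only [PhiR, mul_sub, Finset.sum_sub_distrib]
    congr 1
    rw [← Finset.sum_mul, hμ1, one_mul]
  -- assemble
  unfold GR
  rw [hNf]
  linarith [hdomsum, hsumvert, hPhi]

/-! ## The kernel-checked composition -/

/-- **Pure logic of the line** (no sorry, no stub used): S0 → S1a → S1b → S2 → S3 → S4 → S5 → the crux, written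
in the window-predicate form of the landed mirror (`PhononStabilityOn (Adm ∧ Inner)`, equal to the crux by
`phononStability_iff_on`).  Order of play: label model and pull-back at the datum; tail control at the datum
(`Fform ≥ GR`); dilation to an extreme point (`GR ≥ s¹⁰·GR_ext`); vertex principle there (`GR_ext ≥ 0`). [folklore] -/
theorem composition (h0 : LatticeSum) (h1a : LabelModel) (h1 : PullbackReduction) (h2 : WindowGeometry)
    (h3 : TailControl) (h4 : DilationReduction) (h5 : VertexCertificate) :
    PhononStabilityOn fun t A => Adm₀ A ∧ Inner₀ t A := by
  obtain ⟨κ, hκ, R, hR, n, V, hcov, hcoe⟩ := h5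
  refine ⟨κ, hκ, ?_⟩
  rintro t A ⟨hAdm, hInn⟩ u hu hsupp
  obtain ⟨B, δ, hW, hδ, hAB, hinj, hrange⟩ := h1a t A hAdm hInn
  obtain ⟨w, hw, hred⟩ := h1 t A B δ hW hδ hAB hinj hrange u hu hsupp
  have hls : LatticeSummable w := h0 w hw
  obtain ⟨hsum, hN, hH⟩ := hred hls
  have htail := h3 R hR A B δ w hW hδ hw hls hsum
  have hsplit := Hform_eq_sum_add_tsum R hsum
  obtain ⟨s, hs, hext, hle⟩ := h4 h2 κ hκ.le R A B δ w hW hδ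
  have h0' : 0 ≤ GR κ R (s • A) (s⁻¹ • B) δ w :=
    key_nonneg h2 hcov hcoe hext (contragredient_smul hAB hs.ne') hw
  have hGR : 0 ≤ GR κ R A B δ w := le_trans (mul_nonneg (pow_nonneg hs.le 10) h0') hle
  rw [hN, hH, hsplit]
  unfold GR at hGR
  linarith [htail, hGR]

/-- **Registered anchor `stub_composition`: the crux modulo the vertex certificate.** The six landed reductions
of the line composed with a vertex certificate give the crux `PhononStability` BY NAME (through the landed mirror
`phononStability_iff_on`). [folklore] -/
theorem stub_composition : VertexCertificate → Summit.AtomisticToContinuum.Crystallization.Theses.ExcessDecayLiouville.PhononStability :=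
  fun h5 => phononStability_iff_on.mpr
    (composition LatticeSumStub.stub_latticeSum LabelsStub.stub_labels PullbackStub.stub_pullback
      WindowStub.stub_window TailStub.stub_tail DilationStub.stub_dilation h5)

end Summit.AtomisticToContinuum.Crystallization.Theorems.PhononStabilityCWC.Composition

end
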